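import Summits.BirchSwinnertonDyer.BirchSwinnertonDyer.Theses.SignedLowerHalves
import Literature.NumberTheory.EllipticCurves.AnalyticRank
import Literature.NumberTheory.EllipticCurves.Selmer
import HarnessLib

/-!
# Sketch — crux idea `chromatic-gcd-squeeze` (addendum / merge into `chromatic-common-zeros`)
on `SprungLowerDivisibilityAtThree` (K1).

First lemma (typed, NOT proved): `KobayashiSignedSimpleZeroX8` — on the class X8 at analytic rank one,
the vector `(L♯, L♭)` has a SIMPLE zero at `T = 0`, i.e. `min (ord_T L♯) (ord_T L♭) = 1`
(Kobayashi 2013 Cor. 1.3(i)(ii) + Cor. 4.9: `ord_{s=1} L_p(E, α, s) = 1` for BOTH roots `α`;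
Sprung arXiv:1211.1352 Thm. 5.17 (proof) / Lemma 5.18: `ord_0 L_α = min(ord_0 L♯, ord_0 L♭)` because
`𝓛og_{α,β}(1)` is invertible, `det 𝓛og = log_p(1+T)/T · (β-α)/(ε(p)p)²`).

Second lemma (proved): `colour_transfer_at_T` — the Kato defect is colour-blind, so the `T`-adic
K1 inequality for ONE colour is the `T`-adic K1 inequality for the OTHER.
-/

noncomputable section

open scoped Classical NumberField MatrixGroups ModularForm

open NumberField IsDedekindDomain CongruenceSubgroup WeierstrassCurve
  Literature.NumberTheory.EllipticCurves Literature.NumberTheory.EllipticCurves.ModularForms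
  Literature.NumberTheory.EllipticCurves.ZpExtension Literature.NumberTheory.EllipticCurves.Sprung2017
  Literature.NumberTheory.EllipticCurves.Sprung2012

namespace Summit.BirchSwinnertonDyer.BirchSwinnertonDyer.Cruxes.SprungLowerDivisibilityAtThree.ChromaticGcdSqueeze

/-- **First lemma (Kobayashi–Sprung simple signed zero on X8 at analytic rank one).**
For an X8 curve (`p = 3`, good supersingular, `a₃ = ±3`) of analytic rank `1` and any Sprung pair
`(L♯, L♭)` of its newform, `min (ord_T L♯) (ord_T L♭) = 1`: one colour has a SIMPLE zero at `T = 0`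
(and the other vanishes there too, `L^•(0) = c_• · L(E,1)/Ω = 0`).
Sources: Kobayashi, Invent. Math. 191 (2013) Cor. 1.3(i)(ii), Cor. 4.9, Thm. 5.8 (`(p,N)=1`, `p ∣ a_p`,
`p = 3` allowed, p. 561); Sprung arXiv:1211.1352 Thm. 5.17 (proof: `r_p^α = r^♮`), Lemma 5.18, §2 `det 𝓛og`. -/
def KobayashiSignedSimpleZeroX8 : Prop :=
  ∀ (W : WeierstrassCurve ℚ) [W.IsElliptic] [W.IsGloballyMinimal] (p : ℕ) [Fact p.Prime],
    Literature.NumberTheory.EllipticCurves.Rank1Residual.ClassX8 W p →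
    W.analyticRank = 1 →
    ∀ (N : ℕ) (_ : NeZero N) (f : CuspForm (Gamma0 N) 2) (Lsharp Lflat : IwasawaAlgebra p),
      IsNewformOf W f → IsSprungPair f p (W.frobeniusTrace p) Lsharp Lflat →
      min (PowerSeries.order Lsharp) (PowerSeries.order Lflat) = 1

/-- **The general-rank `T`-adic hypothesis `H_T`** (what remains of the `(T)`-part class-wide):
some colour has `T`-adic order at most the `3^∞`-Selmer corank `s₀ = corank Sel_{3^∞}(E/ℚ)`.
At analytic rank `≤ 1` it is a THEOREM (`KobayashiSignedSimpleZeroX8` + Gross–Zagier); in general it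
is the `p`-adic-BSD rank statement `min_• ord_T L^• = s₀` (Kato gives `≥`). -/
def HT : Prop :=
  ∀ (W : WeierstrassCurve ℚ) [W.IsElliptic] [W.IsGloballyMinimal] (p : ℕ) [Fact p.Prime],
    Literature.NumberTheory.EllipticCurves.Rank1Residual.ClassX8 W p →
    ∀ (N : ℕ) (_ : NeZero N) (f : CuspForm (Gamma0 N) 2) (Lsharp Lflat : IwasawaAlgebra p),
      IsNewformOf W f → IsSprungPair f p (W.frobeniusTrace p) Lsharp Lflat →
      ∃ col : Chroma, PowerSeries.order (chromaticL col Lsharp Lflat)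
        ≤ (W.selmerCorank p : ℕ∞)

/-- **Colour transfer at `T` (proved).** With a JOINT zeta element the chromatic `L`-functions and the
characteristic generators factor as `L^• = h · γ^•`, `gen^• = c₀ · γ^•` (`h` = zeta index,
`c₀` = fine characteristic series, both colour-free). Hence
`ord L♯ + ord gen♭ = ord L♭ + ord gen♯`: the `T`-adic K1 inequality `ord L^• ≤ ord gen^•` holds for
one colour iff for the other (whenever the orders are finite). Pure power-series algebra over a domain. -/
theorem colour_transfer_at_T {R : Type*} [CommRing R] [IsDomain R]
    (h c₀ γs γf Ls Lf gens genf : PowerSeries R)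
    (hLs : Ls = h * γs) (hLf : Lf = h * γf) (hgs : gens = c₀ * γs) (hgf : genf = c₀ * γf) :
    PowerSeries.order Ls + PowerSeries.order genf = PowerSeries.order Lf + PowerSeries.order gens := by
  subst hLs hLf hgs hgf
  simp only [PowerSeries.order_mul]
  abel

/-- Corollary of the transfer identity with finite orders, in `ℕ`: if `a + d = b + c` and `a ≤ c`
then `b ≤ d` (used with `a = ord L^∘, c = ord gen^∘, b = ord L^{∘'}, d = ord gen^{∘'}`). -/
theorem le_of_transfer {a b c d : ℕ} (h : a + d = b + c) (hac : a ≤ c) : b ≤ d := by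
  omega

end Summit.BirchSwinnertonDyer.BirchSwinnertonDyer.Cruxes.SprungLowerDivisibilityAtThree.ChromaticGcdSqueeze

end
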